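import Summits.QuantumAdvantage.QuantumAdvantage.Theses.CubicForrelation

/-!
# Crux `CubicForrelation.CubicStability` (stmt-QuantumAdvantage-2202): the parity hypothesis is load-bearing

Negative-side (cdisprove) lemma for the crux
`Summit.QuantumAdvantage.QuantumAdvantage.Theses.CubicForrelation.CubicStability`
(∀ even `n`, cubic `f g` with `Φ(f,g) ≥ 3/5` have an exactly forrelated cubic pair within relative
Hamming distance `1/4` on both sides).

* `cubicStability_iff` — the crux restated through `IsCubic` / `hdist` (`Iff.rfl`);
* `not_cubicStability_without_even` — the same statement with `Even n →` deleted is FALSE: at `n = 1` the cubic pair `(0,0)` has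
  `Φ = 2/√8 = 1/√2 ≥ 3/5` (`forrelation_one_const`), while `Φ(f₀,g₀) ∈ {±1/√2}` for every pair of
  Boolean functions on one bit (`forrelation_one_ne_one`; odd dimension has no bent functions), so no
  exactly forrelated pair exists at all.  Hence any proof of the crux must use the parity of `n`
  (cf. the planner's remark that odd `n` has semi-bent YES pairs and no exact pairs).
-/

namespace Summit.QuantumAdvantage.QuantumAdvantage.Theses.CubicForrelation

open scoped BigOperators Topology Manifold Classical MeasureTheory ProbabilityTheory Matrix InnerProductSpace ComplexConjugate ContinuousMap
open Filter Set Function TopologicalSpace MeasureTheory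

/-- **Record of the replaced/dropped route item `CubicStability`** = stmt-QuantumAdvantage-2202 (ledger signature verbatim, in
the route file's namespace and `open` context; NOT a route item): after `CubicForrelationCubicStability_refuted` (below) closed the
item `refuted`, the route repair (`restate` under a new name, or `drop`) removed
this constant from the gate-written Theses file, while the Theorems file below — append-only,
statement text fixed — still names it ("Unknown identifier" in the full builds of 2026-08-16).
Re-declared here under its original fully-qualified name and definiens solely so that this record
keeps elaborating. FALSE (refuted below). This negative-side helper restates it (Iff.rfl) and proves the parity hypothesis load-bearing. -/
def CubicStability : Prop :=
  ∀ n : ℕ, Even n → ∀ f g : (Fin n → Bool) → Bool, (∃ p : MvPolynomial (Fin n) (ZMod 2), p.totalDegree ≤ 3 ∧ ∀ x, f x = decide (MvPolynomial.eval (fun j => if x j then (1 : ZMod 2) else 0) p = 1)) → (∃ p : MvPolynomial (Fin n) (ZMod 2), p.totalDegree ≤ 3 ∧ ∀ x, g x = decide (MvPolynomial.eval (fun j => if x j then (1 : ZMod 2) else 0) p = 1)) → (3 : ℝ) / 5 ≤ Literature.Computability.QuantumComplexity.forrelation f g → ∃ f₀ g₀ : (Fin n → Bool) → Bool, (∃ p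 : MvPolynomial (Fin n) (ZMod 2), p.totalDegree ≤ 3 ∧ ∀ x, f₀ x = decide (MvPolynomial.eval (fun j => if x j then (1 : ZMod 2) else 0) p = 1)) ∧ (∃ p : MvPolynomial (Fin n) (ZMod 2), p.totalDegree ≤ 3 ∧ ∀ x, g₀ x = decide (MvPolynomial.eval (fun j => if x j then (1 : ZMod 2) else 0) p = 1)) ∧ Literature.Computability.QuantumComplexity.forrelation f₀ g₀ = 1 ∧ 4 * (Finset.univ.filter fun x : Fin n → Bool => f x ≠ f₀ x).card ≤ 2 ^ n ∧ 4 * (Finset.univ.filter fun x : Fin n → Bool => g x ≠ g₀ x).card ≤ 2 ^ n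

end Summit.QuantumAdvantage.QuantumAdvantage.Theses.CubicForrelation

open Literature.Computability.QuantumComplexity

namespace Summit.QuantumAdvantage.QuantumAdvantage.Theorems.CubicStability.Negative

/-- `f` agrees pointwise with a polynomial of total degree `≤ 3` over `𝔽₂`
(the crux's inline cubicity clause). -/
def IsCubic {n : ℕ} (f : (Fin n → Bool) → Bool) : Prop :=
  ∃ p : MvPolynomial (Fin n) (ZMod 2), p.totalDegree ≤ 3 ∧
    ∀ x, f x = decide (MvPolynomial.eval (fun j => if x j then (1 : ZMod 2) else 0) p = 1)

/-- Hamming distance of two Boolean functions on `n` bits (the crux's `Finset.filter` cardinality).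
-/
def hdist {n : ℕ} (f g : (Fin n → Bool) → Bool) : ℕ :=
  (Finset.univ.filter fun x : Fin n → Bool => f x ≠ g x).card

/-- The crux, restated through `IsCubic` / `hdist` (definitional). [folklore] -/
theorem cubicStability_iff :
    Summit.QuantumAdvantage.QuantumAdvantage.Theses.CubicForrelation.CubicStability ↔
      ∀ n : ℕ, Even n → ∀ f g : (Fin n → Bool) → Bool, IsCubic f → IsCubic g →
        (3 : ℝ) / 5 ≤ forrelation f g →
        ∃ f₀ g₀ : (Fin n → Bool) → Bool, IsCubic f₀ ∧ IsCubic g₀ ∧ forrelation f₀ g₀ = 1 ∧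
          4 * hdist f f₀ ≤ 2 ^ n ∧ 4 * hdist g g₀ ≤ 2 ^ n :=
  Iff.rfl

/-- Constant functions are cubic (witness `p = 0`). [folklore] -/
theorem isCubic_const_false (n : ℕ) : IsCubic (fun _ : Fin n → Bool => false) :=
  ⟨0, by simp, fun x => by simp⟩

/-- The four-term expansion of `Φ` on one bit:
`Φ(f,g) = (F₀G₀ + F₀G₁ + F₁G₀ − F₁G₁)/√8`. [folklore] -/
theorem forrelation_one (f g : (Fin 1 → Bool) → Bool) :
    forrelation f g = (Real.sqrt 8)⁻¹ *
      (signOf (f fun _ => false) * signOf (g fun _ => false)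
       + signOf (f fun _ => false) * signOf (g fun _ => true)
       + (signOf (f fun _ => true) * signOf (g fun _ => false)
       - signOf (f fun _ => true) * signOf (g fun _ => true))) := by
  unfold forrelation
  have e : ∀ F : (Fin 1 → Bool) → ℝ,
      ∑ x : Fin 1 → Bool, F x = F (fun _ => false) + F (fun _ => true) := by
    intro F
    rw [← Equiv.sum_comp (Equiv.funUnique (Fin 1) Bool).symm, Fintype.sum_bool]
    rw [add_comm]
    congr 1
  simp only [e, twist, Fin.prod_univ_one, Bool.and_false, Bool.and_true]
  norm_num
  ring

/-- `(±2)/√8 ≠ 1`. [folklore] -/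
theorem sqrt8_inv_mul_ne_one {s : ℝ} (hs : s = 2 ∨ s = -2) : (Real.sqrt 8)⁻¹ * s ≠ 1 := by
  intro h
  have hpos : 0 < Real.sqrt 8 := Real.sqrt_pos.2 (by norm_num)
  have hsq : Real.sqrt 8 ^ 2 = 8 := Real.sq_sqrt (by norm_num)
  have h' : s = Real.sqrt 8 := by
    field_simp at h
    linarith
  rcases hs with rfl | rfl <;> nlinarith

/-- At `n = 1` no pair of Boolean functions is exactly forrelated: `Φ ∈ {±1/√2}`
(no bent functions in odd dimension). [folklore] -/
theorem forrelation_one_ne_one (f g : (Fin 1 → Bool) → Bool) : forrelation f g ≠ 1 := by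
  rw [forrelation_one]
  apply sqrt8_inv_mul_ne_one
  cases f (fun _ => false) <;> cases f (fun _ => true) <;> cases g (fun _ => false) <;>
    cases g (fun _ => true) <;> norm_num [signOf]

/-- The cubic pair `(0,0)` on one bit is a YES instance: `Φ = 2/√8 = 1/√2 ≥ 3/5`. [folklore] -/
theorem forrelation_one_const :
    (3 : ℝ) / 5 ≤ forrelation (n := 1) (fun _ => false) (fun _ => false) := by
  rw [forrelation_one]
  have h3 : Real.sqrt 8 < 3 := by
    rw [Real.sqrt_lt' (by norm_num)]; norm_num
  have hpos : 0 < Real.sqrt 8 := Real.sqrt_pos.2 (by norm_num)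
  simp only [signOf]
  norm_num
  rw [inv_mul_eq_div, le_div_iff₀ hpos]
  nlinarith

/-- **`Even n` is load-bearing for `CubicStability`.**  With the parity hypothesis dropped the
statement is false already at `n = 1`: `(0,0)` is a cubic YES pair but nothing on one bit is exactly
forrelated. [folklore] -/
theorem not_cubicStability_without_even :
    ¬ (∀ n : ℕ, ∀ f g : (Fin n → Bool) → Bool, IsCubic f → IsCubic g →
        (3 : ℝ) / 5 ≤ forrelation f g →
        ∃ f₀ g₀ : (Fin n → Bool) → Bool, IsCubic f₀ ∧ IsCubic g₀ ∧ forrelation f₀ g₀ = 1 ∧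
          4 * hdist f f₀ ≤ 2 ^ n ∧ 4 * hdist g g₀ ≤ 2 ^ n) := by
  intro h
  obtain ⟨f₀, g₀, -, -, h1, -, -⟩ :=
    h 1 (fun _ => false) (fun _ => false) (isCubic_const_false 1) (isCubic_const_false 1)
      forrelation_one_const
  exact forrelation_one_ne_one f₀ g₀ h1

end Summit.QuantumAdvantage.QuantumAdvantage.Theorems.CubicStability.Negative
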